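import Mathlib
import HarnessLib

/-!
# The jackknife bias correction of a POOLED RATIO: the exact second-order formula

HONEST FRAMING: exact (Metropolis-corrected) sampling algorithms for lattice gauge theory;
figures of merit are autocorrelation/cost numbers at stated couplings and volumes; no
continuum-physics claim.

Venture `LatticeQCDFlow` (cell pub-lqcd), topic `Exactness`; FANOUT row 13 (`eng-snf`, GEN-25).
NEW WORK of the cell (elementary algebra), Mathlib only; not a published result; no definition;
nothing cited as a fact (Quenouille / Tukey NAMED ONLY).  Companion of GEN-25
`NCMCGeneralSpaceReplicaJackknifeBiasSize` (the same question for `dF = −log ȳ`) and of the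
staged `…ReplicaJackknifeRatio` (limiting coverage of the pooled-ratio bar).

WHY (row 13).  `estimators.jackknife(kind = reweighted_mean)` prints, for `R ≥ 2` blocks with
per-block numerator sums `a_r = Σ_j w_{rj} O_{rj}` and denominator sums `b_r = Σ_j w_{rj} > 0`,
the pooled ratio `θ = A/B` (`A = Σ_r a_r`, `B = Σ_r b_r`), the delete-one-block replicates
`θ_{(−r)} = (A − a_r)/(B − b_r)` and the Quenouille–Tukey corrected value
`bias_corr = R·θ − (R−1)·(1/R)Σ_r θ_{(−r)}`.  With the block RESIDUALS `e_r = a_r − θ·b_r`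
(`Σ_r e_r = 0`) everything is explicit:

  `θ_{(−r)} − θ = −e_r/(B − b_r)`                      (`looRatio_sub_ratio_eq`),
  `(1/R)Σ_r θ_{(−r)} − θ = −(1/R) Σ_r e_r·b_r /(B(B − b_r))`   (`mean_looRatio_sub_ratio_eq`;
  the first-order part `−(1/R)Σ_r e_r/B` VANISHES), hence

  **`θ − bias_corr = −((R−1)/R) · Σ_r e_r·b_r / (B·(B − b_r))`**  (`ratio_sub_biasCorrected_eq`)

— a residual × weight-share cross term, i.e. SECOND ORDER; and if every block's odds of weight
`b_r/(B − b_r) ≤ κ` then **`|θ − bias_corr| ≤ ((R−1)/R)·(κ/B)·Σ_r |e_r|`**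
(`abs_ratio_sub_biasCorrected_le`).  For blocks of comparable weight (`κ ≈ 1/(R−1)`) this is
`≲ (1/(R·B)) Σ_r |e_r|`, one power of `R^{−1/2}` below the half-width `∝ (Σ_r e_r²)^{1/2}/B`
of the jackknife bar; a large printed correction flags ONE block carrying most of the weight
AND an atypical block estimate at the same time.

NOT CLAIMED: anything stochastic (coverage of the ratio bar is the staged
`…ReplicaJackknifeRatio`); anything numerical.
-/

namespace Summit.Ventures.LatticeQCDFlow.Exactness.GeneralNCMC

open Finset

section RatioBias

variable {ι : Type*} [Fintype ι]

omit [Fintype ι] in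
/-- **`θ_{(−r)} − θ = −e_r/(B − b_r)`** with the residual `e_r = a_r − θ b_r`
(`θ = A/B`, `B ≠ 0`, `B − b_r ≠ 0`). -/
theorem looRatio_sub_ratio_eq {a b : ι → ℝ} {A B θ : ℝ} (hθ : θ = A / B) (hB0 : B ≠ 0)
    (r : ι) (hBr : B - b r ≠ 0) :
    (A - a r) / (B - b r) - θ = -(a r - θ * b r) / (B - b r) := by
  rw [hθ]
  field_simp
  ring

/-- **The residuals sum to zero**: `Σ_r (a_r − θ b_r) = A − θ B = 0`. -/
theorem sum_ratioResidual_eq_zero {a b : ι → ℝ} {A B θ : ℝ} (hA : A = ∑ r, a r)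
    (hB : B = ∑ r, b r) (hθ : θ = A / B) (hB0 : B ≠ 0) :
    ∑ r, (a r - θ * b r) = 0 := by
  rw [sum_sub_distrib, ← mul_sum, ← hA, ← hB, hθ, div_mul_cancel₀ A hB0, sub_self]

/-- **`(1/R)Σ_r θ_{(−r)} − θ = −(1/R) Σ_r e_r b_r/(B(B − b_r))`** — the first-order part
`−(1/R)Σ_r e_r/B` vanishes because the residuals sum to zero. -/
theorem mean_looRatio_sub_ratio_eq [Nonempty ι] {a b : ι → ℝ} {A B θ : ℝ} (hA : A = ∑ r, a r)
    (hB : B = ∑ r, b r) (hθ : θ = A / B) (hB0 : B ≠ 0) (hBr : ∀ r, B - b r ≠ 0) :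
    (∑ r, (A - a r) / (B - b r)) / Fintype.card ι - θ
      = -((∑ r, (a r - θ * b r) * b r / (B * (B - b r))) / Fintype.card ι) := by
  have hR0 : (Fintype.card ι : ℝ) ≠ 0 := by positivity
  -- `(Σ θ_{(−r)})/R − θ = (Σ (θ_{(−r)} − θ))/R`
  have step1 : (∑ r, (A - a r) / (B - b r)) / Fintype.card ι - θ
      = (∑ r, ((A - a r) / (B - b r) - θ)) / Fintype.card ι := by
    rw [sum_sub_distrib, sum_const, card_univ, nsmul_eq_mul, sub_div,
      mul_div_cancel_left₀ θ hR0]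
  -- `θ_{(−r)} − θ = −e_r b_r/(B(B − b_r)) − e_r/B`
  have hterm : ∀ r, (A - a r) / (B - b r) - θ
      = -((a r - θ * b r) * b r / (B * (B - b r))) - (a r - θ * b r) / B := fun r => by
    have h1 := hBr r
    rw [hθ]
    field_simp
    ring
  rw [step1, sum_congr rfl fun r _ => hterm r, sum_sub_distrib, sum_neg_distrib, ← sum_div,
    sum_ratioResidual_eq_zero hA hB hθ hB0, zero_div, sub_zero, neg_div]

/-- **`θ − bias_corr = −((R−1)/R) Σ_r e_r b_r/(B(B − b_r))`** — the Quenouille–Tukey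
correction of the pooled ratio is the residual × weight-share cross term (second order). -/
theorem ratio_sub_biasCorrected_eq [Nonempty ι] {a b : ι → ℝ} {A B θ : ℝ} (hA : A = ∑ r, a r)
    (hB : B = ∑ r, b r) (hθ : θ = A / B) (hB0 : B ≠ 0) (hBr : ∀ r, B - b r ≠ 0) :
    θ - ((Fintype.card ι : ℝ) * θ
          - ((Fintype.card ι : ℝ) - 1) * ((∑ r, (A - a r) / (B - b r)) / Fintype.card ι))
      = -(((Fintype.card ι : ℝ) - 1) / Fintype.card ι
          * ∑ r, (a r - θ * b r) * b r / (B * (B - b r))) := by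
  have hR0 : (Fintype.card ι : ℝ) ≠ 0 := by positivity
  have h := mean_looRatio_sub_ratio_eq hA hB hθ hB0 hBr
  -- `θ − bc = (R−1)((Σθ_{(−r)})/R − θ)`
  have halg : θ - ((Fintype.card ι : ℝ) * θ
        - ((Fintype.card ι : ℝ) - 1) * ((∑ r, (A - a r) / (B - b r)) / Fintype.card ι))
      = ((Fintype.card ι : ℝ) - 1)
          * ((∑ r, (A - a r) / (B - b r)) / Fintype.card ι - θ) := by ring
  rw [halg, h, mul_neg, div_mul_eq_mul_div, mul_div_assoc]

/-- **`|θ − bias_corr| ≤ ((R−1)/R)·(κ/B)·Σ_r |e_r|`** when every block's odds of weight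
`b_r/(B − b_r) ≤ κ` (`b_r ≥ 0`, `B > b_r`, `B > 0`). -/
theorem abs_ratio_sub_biasCorrected_le [Nonempty ι] {a b : ι → ℝ} {A B θ : ℝ} (hA : A = ∑ r, a r)
    (hB : B = ∑ r, b r) (hθ : θ = A / B) (hBpos : 0 < B) (hb : ∀ r, 0 ≤ b r)
    (hBr : ∀ r, b r < B) {κ : ℝ} (hκ : ∀ r, b r / (B - b r) ≤ κ) :
    |θ - ((Fintype.card ι : ℝ) * θ
          - ((Fintype.card ι : ℝ) - 1) * ((∑ r, (A - a r) / (B - b r)) / Fintype.card ι))|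
      ≤ ((Fintype.card ι : ℝ) - 1) / Fintype.card ι * (κ / B * ∑ r, |a r - θ * b r|) := by
  have hBr' : ∀ r, B - b r ≠ 0 := fun r => (sub_pos.mpr (hBr r)).ne'
  have hR1 : (0 : ℝ) ≤ (Fintype.card ι : ℝ) - 1 := by
    have : (1 : ℝ) ≤ Fintype.card ι := by exact_mod_cast Fintype.card_pos
    linarith
  rw [ratio_sub_biasCorrected_eq hA hB hθ hBpos.ne' hBr', abs_neg, abs_mul,
    abs_of_nonneg (div_nonneg hR1 (Nat.cast_nonneg _))]
  refine mul_le_mul_of_nonneg_left ?_ (div_nonneg hR1 (Nat.cast_nonneg _))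
  -- `|Σ e_r b_r/(B(B−b_r))| ≤ Σ |e_r|·(b_r/(B − b_r))/B ≤ (κ/B) Σ |e_r|`
  refine (abs_sum_le_sum_abs _ _).trans ?_
  rw [mul_sum]
  refine sum_le_sum fun r _ => ?_
  have hodds : 0 ≤ b r / (B - b r) := div_nonneg (hb r) (sub_pos.mpr (hBr r)).le
  rw [abs_div, abs_mul, abs_of_nonneg (hb r), abs_of_pos (mul_pos hBpos (sub_pos.mpr (hBr r)))]
  calc |a r - θ * b r| * b r / (B * (B - b r))
      = b r / (B - b r) / B * |a r - θ * b r| := by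
        field_simp
    _ ≤ κ / B * |a r - θ * b r| :=
        mul_le_mul_of_nonneg_right (div_le_div_of_nonneg_right (hκ r) hBpos.le) (abs_nonneg _)

end RatioBias

end Summit.Ventures.LatticeQCDFlow.Exactness.GeneralNCMC
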